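import Mathlib
import Summits.PneNP.PneNP.Theorems.ConvexRankGatesConvexGateBlindAffinePencilMoment

/-!
# PneNP / ConvexRankGates — `ConvexGateBlind`: quadratic forms of `2 × 2` matrices along the circle have at most two zeros

Helpers (`--supports stmt-PneNP-10680`), COLUMN-SPACE line (prover seat 2, session 26), PSD side: the analytic ingredient of
the first UPPER bound on the pencil exclusion number (`…AffinePencilTwoBound.lean`, memo ANALYSIS-seat2-s26 §3.1). Directions
`y ∈ ℝ²` modulo sign are parametrised root-free by `u ∈ (−1, 1]`, `y(u) = (u, √(1−u²))`; the doubled point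
`P(u) = (2u² − 1, 2u√(1−u²))` (`= (cos 2φ, sin 2φ)`) lies on the unit circle (`circlePt_unit`) and `u ↦ P(u)` is injective
on `(−1, 1]` (`circlePt_injOn`). A quadratic form evaluated at `y(u)` is an AFFINE function of `P(u)`
(`quadForm_circleParam`), so its zero set is a line meeting the circle: by strict convexity of the disc three distinct unit
vectors are never collinear (`not_collinear_three_unit`), hence a non-constant such function has NO THREE ZEROS in
`(−1, 1]` (`circleAffine_no_three_zeros`) — and therefore changes sign from `+` to `−` on at most two of any family of
pairwise separated intervals (`circleAffine_signChanges_le_two`, intermediate value theorem). [folklore]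
-/

set_option linter.dupNamespace false

namespace Summit.PneNP.PneNP.Theorems

open Finset Real Matrix

noncomputable section

/-! ## The root-free half-circle parametrisation -/

/-- The direction `y(u) = (u, √(1 − u²))` of the closed upper half circle. [folklore] -/
def halfDir (u : ℝ) : Fin 2 → ℝ := ![u, Real.sqrt (1 - u ^ 2)]

/-- The doubled point `P(u) = (2u² − 1, 2u√(1−u²))` (the point `(cos 2φ, sin 2φ)` for `y(u) = (cos φ, sin φ)`). [folklore] -/
def circlePt (u : ℝ) : Fin 2 → ℝ := ![2 * u ^ 2 - 1, 2 * u * Real.sqrt (1 - u ^ 2)]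

/-- `√(1−u²)² = 1 − u²` on `[−1, 1]`. [folklore] -/
theorem sq_sqrt_one_sub_sq {u : ℝ} (hu : u ^ 2 ≤ 1) : Real.sqrt (1 - u ^ 2) ^ 2 = 1 - u ^ 2 :=
  Real.sq_sqrt (by linarith)

/-- `P(u)` is a unit vector for `u² ≤ 1`. [folklore] -/
theorem circlePt_unit {u : ℝ} (hu : u ^ 2 ≤ 1) : circlePt u ⬝ᵥ circlePt u = 1 := by
  have h := sq_sqrt_one_sub_sq hu
  simp only [circlePt, dotProduct, Fin.sum_univ_two, Matrix.cons_val_zero, Matrix.cons_val_one]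
  nlinarith [h]

/-- `v² = 1` iff `v = ±1`. [folklore] -/
theorem eq_one_or_eq_neg_one_of_sq_eq_one {v : ℝ} (h : v ^ 2 = 1) : v = 1 ∨ v = -1 := by
  have : (v - 1) * (v + 1) = 0 := by ring_nf; linarith
  rcases mul_eq_zero.1 this with h | h
  · left; linarith
  · right; linarith

/-- **`u ↦ P(u)` is injective on `(−1, 1]`.** [folklore] -/
theorem circlePt_injOn : Set.InjOn circlePt (Set.Ioc (-1 : ℝ) 1) := by
  intro u hu v hv h
  have h0 := congrFun h 0
  have h1 := congrFun h 1
  simp only [circlePt, Matrix.cons_val_zero, Matrix.cons_val_one] at h0 h1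
  have hsq : u ^ 2 = v ^ 2 := by linarith
  have hs : Real.sqrt (1 - u ^ 2) = Real.sqrt (1 - v ^ 2) := by rw [hsq]
  rw [hs] at h1
  rcases sq_eq_sq_iff_eq_or_eq_neg.1 hsq with huv | huv
  · exact huv
  · -- `u = −v`: then `v √(1−v²) = 0`
    subst huv
    have h2 : v * Real.sqrt (1 - v ^ 2) = 0 := by linarith
    rcases mul_eq_zero.1 h2 with hv0 | hr
    · subst hv0; simp
    · have hvs : 1 - v ^ 2 ≤ 0 := Real.sqrt_eq_zero'.1 hr
      have hv1 : v ^ 2 ≤ 1 := by obtain ⟨h1, h2⟩ := hv; nlinarith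
      have hv' : v ^ 2 = 1 := le_antisymm hv1 (by linarith)
      rcases eq_one_or_eq_neg_one_of_sq_eq_one hv' with rfl | rfl
      · exact absurd hu.1 (by norm_num)
      · exact absurd hv.1 (by norm_num)

/-- **A quadratic form along the half circle is an affine function of the doubled point**: for a `2 × 2` matrix `M`,
`y(u)ᵀ M y(u) = (M₀₀+M₁₁)/2 + ((M₀₀−M₁₁)/2)·P(u)₀ + ((M₀₁+M₁₀)/2)·P(u)₁` on `u² ≤ 1`. [folklore] -/
theorem quadForm_circleParam (M : Matrix (Fin 2) (Fin 2) ℝ) {u : ℝ} (hu : u ^ 2 ≤ 1) :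
    halfDir u ⬝ᵥ (M *ᵥ halfDir u) =
      (M 0 0 + M 1 1) / 2 + (M 0 0 - M 1 1) / 2 * circlePt u 0 + (M 0 1 + M 1 0) / 2 * circlePt u 1 := by
  have h := sq_sqrt_one_sub_sq hu
  simp only [halfDir, circlePt, Matrix.mulVec, dotProduct, Fin.sum_univ_two, Matrix.cons_val_zero, Matrix.cons_val_one]
  linear_combination (M 1 1) * h

/-! ## Three unit vectors are never collinear -/

/-- **Strict convexity of the disc**: a strict convex combination of two distinct unit vectors is not a unit vector. [folklore] -/
theorem dotProduct_self_convexComb_lt_one {d : ℕ} {p r : Fin d → ℝ} (hp : p ⬝ᵥ p = 1) (hr : r ⬝ᵥ r = 1)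
    (hne : p ≠ r) {t : ℝ} (ht0 : 0 < t) (ht1 : t < 1) :
    (t • p + (1 - t) • r) ⬝ᵥ (t • p + (1 - t) • r) < 1 := by
  have hlt := dotProduct_lt_one_of_ne hp hr hne
  have hexp : (t • p + (1 - t) • r) ⬝ᵥ (t • p + (1 - t) • r) =
      t ^ 2 + (1 - t) ^ 2 + 2 * t * (1 - t) * (p ⬝ᵥ r) := by
    simp only [add_dotProduct, dotProduct_add, smul_dotProduct, dotProduct_smul, smul_eq_mul, hp, hr, dotProduct_comm r p]
    ring
  rw [hexp]
  nlinarith [mul_pos ht0 (by linarith : (0 : ℝ) < 1 - t)]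

/-- On the line `α + βX + γY = 0` (`(β,γ) ≠ 0`) a point is an affine function of its coordinate `s = −γX + βY`. [folklore] -/
theorem line_coords {α β γ : ℝ} (hN : 0 < β ^ 2 + γ ^ 2) {p : Fin 2 → ℝ} (hline : α + β * p 0 + γ * p 1 = 0)
    (s : ℝ) (hs : s = -γ * p 0 + β * p 1) :
    p 0 = (-α * β - γ * s) / (β ^ 2 + γ ^ 2) ∧ p 1 = (-α * γ + β * s) / (β ^ 2 + γ ^ 2) := by
  subst hs
  constructor
  · rw [eq_div_iff hN.ne']; linear_combination β * hline
  · rw [eq_div_iff hN.ne']; linear_combination γ * hline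

/-- **Three distinct unit vectors of `ℝ²` are not on a common line** `α + β X + γ Y = 0` (`(β, γ) ≠ 0`): the middle one (along
the line) would be a strict convex combination of the other two. [folklore] -/
theorem not_collinear_three_unit {α β γ : ℝ} (hβγ : β ≠ 0 ∨ γ ≠ 0) {p₁ p₂ p₃ : Fin 2 → ℝ}
    (hu₁ : p₁ ⬝ᵥ p₁ = 1) (hu₂ : p₂ ⬝ᵥ p₂ = 1) (hu₃ : p₃ ⬝ᵥ p₃ = 1)
    (hl₁ : α + β * p₁ 0 + γ * p₁ 1 = 0) (hl₂ : α + β * p₂ 0 + γ * p₂ 1 = 0) (hl₃ : α + β * p₃ 0 + γ * p₃ 1 = 0)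
    (h₁₂ : p₁ ≠ p₂) (h₁₃ : p₁ ≠ p₃) (h₂₃ : p₂ ≠ p₃) : False := by
  have hN : 0 < β ^ 2 + γ ^ 2 := by
    rcases hβγ with h | h
    · have := sq_pos_of_ne_zero h; nlinarith [sq_nonneg γ]
    · have := sq_pos_of_ne_zero h; nlinarith [sq_nonneg β]
  -- generic step: among unit points on the line with coordinates `sa < sb < sc`, the middle one is not a unit vector
  have key : ∀ {a b c : Fin 2 → ℝ}, a ⬝ᵥ a = 1 → b ⬝ᵥ b = 1 → c ⬝ᵥ c = 1 →
      α + β * a 0 + γ * a 1 = 0 → α + β * b 0 + γ * b 1 = 0 → α + β * c 0 + γ * c 1 = 0 → a ≠ c →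
      (-γ * a 0 + β * a 1) < (-γ * b 0 + β * b 1) → (-γ * b 0 + β * b 1) < (-γ * c 0 + β * c 1) → False := by
    intro a b c ha hb hc hla hlb hlc hac hab hbc
    set sa := -γ * a 0 + β * a 1 with hsa
    set sb := -γ * b 0 + β * b 1 with hsb'
    set sc := -γ * c 0 + β * c 1 with hsc
    obtain ⟨ha0, ha1⟩ := line_coords hN hla sa hsa
    obtain ⟨hb0, hb1⟩ := line_coords hN hlb sb hsb'
    obtain ⟨hc0, hc1⟩ := line_coords hN hlc sc hsc
    set t : ℝ := (sc - sb) / (sc - sa) with ht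
    have hden : 0 < sc - sa := by linarith
    have ht0 : 0 < t := div_pos (by linarith) hden
    have ht1 : t < 1 := by rw [ht, div_lt_one hden]; linarith
    have hsb : sb = t * sa + (1 - t) * sc := by rw [ht]; field_simp; ring
    have hbcomb : b = t • a + (1 - t) • c := by
      have e0 : b 0 = t * a 0 + (1 - t) * c 0 := by
        rw [hb0, ha0, hc0, hsb]; field_simp; ring
      have e1 : b 1 = t * a 1 + (1 - t) * c 1 := by
        rw [hb1, ha1, hc1, hsb]; field_simp; ring
      ext i
      fin_cases i
      · simpa using e0
      · simpa using e1
    have hlt := dotProduct_self_convexComb_lt_one ha hc hac ht0 ht1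
    rw [← hbcomb, hb] at hlt
    exact lt_irrefl _ hlt
  -- the three coordinates are distinct
  set s₁ := -γ * p₁ 0 + β * p₁ 1 with hs₁
  set s₂ := -γ * p₂ 0 + β * p₂ 1 with hs₂
  set s₃ := -γ * p₃ 0 + β * p₃ 1 with hs₃
  have hdet : ∀ {a b : Fin 2 → ℝ}, α + β * a 0 + γ * a 1 = 0 → α + β * b 0 + γ * b 1 = 0 →
      (-γ * a 0 + β * a 1) = (-γ * b 0 + β * b 1) → a = b := by
    intro a b hla hlb hs
    obtain ⟨ha0, ha1⟩ := line_coords hN hla _ rfl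
    obtain ⟨hb0, hb1⟩ := line_coords hN hlb _ rfl
    have e0 : a 0 = b 0 := by rw [ha0, hb0, hs]
    have e1 : a 1 = b 1 := by rw [ha1, hb1, hs]
    ext i; fin_cases i
    · simpa using e0
    · simpa using e1
  have n₁₂ : s₁ ≠ s₂ := fun h => h₁₂ (hdet hl₁ hl₂ h)
  have n₁₃ : s₁ ≠ s₃ := fun h => h₁₃ (hdet hl₁ hl₃ h)
  have n₂₃ : s₂ ≠ s₃ := fun h => h₂₃ (hdet hl₂ hl₃ h)
  rcases lt_or_gt_of_ne n₁₂ with a | a <;> rcases lt_or_gt_of_ne n₁₃ with b | b <;> rcases lt_or_gt_of_ne n₂₃ with c | c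
  · exact key hu₁ hu₂ hu₃ hl₁ hl₂ hl₃ h₁₃ a c
  · exact key hu₁ hu₃ hu₂ hl₁ hl₃ hl₂ h₁₂ b c
  · exact lt_irrefl _ ((b.trans a).trans c)
  · exact key hu₃ hu₁ hu₂ hl₃ hl₁ hl₂ (Ne.symm h₂₃) b a
  · exact key hu₂ hu₁ hu₃ hl₂ hl₁ hl₃ h₂₃ a b
  · exact lt_irrefl _ ((a.trans b).trans c)
  · exact key hu₂ hu₃ hu₁ hl₂ hl₃ hl₁ (Ne.symm h₁₂) c b
  · exact key hu₃ hu₂ hu₁ hl₃ hl₂ hl₁ (Ne.symm h₁₃) c a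

/-! ## Affine functions of the doubled point: at most two zeros, at most two sign changes -/

/-- The affine function `α + β P(u)₀ + γ P(u)₁` of the doubled point. [folklore] -/
def circleAffine (α β γ : ℝ) (u : ℝ) : ℝ := α + β * circlePt u 0 + γ * circlePt u 1

/-- `circleAffine` is continuous. [folklore] -/
theorem continuous_circleAffine (α β γ : ℝ) : Continuous (circleAffine α β γ) := by
  unfold circleAffine circlePt
  simp only [Matrix.cons_val_zero, Matrix.cons_val_one]
  fun_prop

/-- **No three zeros in `(−1, 1]`** unless `β = γ = 0`. [folklore] -/
theorem circleAffine_no_three_zeros {α β γ : ℝ} (hβγ : β ≠ 0 ∨ γ ≠ 0) {z₁ z₂ z₃ : ℝ} (h₁₂ : z₁ < z₂) (h₂₃ : z₂ < z₃)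
    (hz₁ : -1 < z₁) (hz₃ : z₃ ≤ 1) (hq₁ : circleAffine α β γ z₁ = 0) (hq₂ : circleAffine α β γ z₂ = 0)
    (hq₃ : circleAffine α β γ z₃ = 0) : False := by
  have m₁ : z₁ ∈ Set.Ioc (-1 : ℝ) 1 := ⟨hz₁, by linarith⟩
  have m₂ : z₂ ∈ Set.Ioc (-1 : ℝ) 1 := ⟨by linarith, by linarith⟩
  have m₃ : z₃ ∈ Set.Ioc (-1 : ℝ) 1 := ⟨by linarith, hz₃⟩
  have sq : ∀ {z : ℝ}, z ∈ Set.Ioc (-1 : ℝ) 1 → z ^ 2 ≤ 1 := fun ⟨h1, h2⟩ => by nlinarith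
  refine not_collinear_three_unit hβγ (circlePt_unit (sq m₁)) (circlePt_unit (sq m₂)) (circlePt_unit (sq m₃))
    hq₁ hq₂ hq₃ (fun h => ?_) (fun h => ?_) (fun h => ?_)
  · have := circlePt_injOn m₁ m₂ h; linarith
  · have := circlePt_injOn m₁ m₃ h; linarith
  · have := circlePt_injOn m₂ m₃ h; linarith

/-- A sign change on `[s, t]` produces a zero in `(s, t)`. [folklore] -/
theorem circleAffine_exists_zero {α β γ s t : ℝ} (hst : s < t) (hpos : 0 < circleAffine α β γ s)
    (hneg : circleAffine α β γ t < 0) : ∃ z ∈ Set.Ioo s t, circleAffine α β γ z = 0 := by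
  have hcont : ContinuousOn (circleAffine α β γ) (Set.Icc s t) := (continuous_circleAffine α β γ).continuousOn
  have h0 : (0 : ℝ) ∈ Set.Ioo (circleAffine α β γ t) (circleAffine α β γ s) := ⟨hneg, hpos⟩
  obtain ⟨z, hz, hz0⟩ := intermediate_value_Ioo' hst.le hcont h0
  exact ⟨z, hz, hz0⟩

/-- **At most two `+ → −` sign changes on separated intervals.** If `α + βP(u)₀ + γP(u)₁` is positive at `sⱼ` and
negative at `tⱼ` for three intervals `s₁ < t₁ ≤ s₂ < t₂ ≤ s₃ < t₃` inside `(−1, 1]`, contradiction. [folklore] -/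
theorem circleAffine_signChanges_le_two {α β γ s₁ t₁ s₂ t₂ s₃ t₃ : ℝ} (h₁ : s₁ < t₁) (h₁₂ : t₁ ≤ s₂) (h₂ : s₂ < t₂)
    (h₂₃ : t₂ ≤ s₃) (h₃ : s₃ < t₃) (hlo : -1 < s₁) (hhi : t₃ ≤ 1)
    (hp₁ : 0 < circleAffine α β γ s₁) (hn₁ : circleAffine α β γ t₁ < 0)
    (hp₂ : 0 < circleAffine α β γ s₂) (hn₂ : circleAffine α β γ t₂ < 0)
    (hp₃ : 0 < circleAffine α β γ s₃) (hn₃ : circleAffine α β γ t₃ < 0) : False := by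
  -- `(β, γ) ≠ 0`, else the function is constant
  have hβγ : β ≠ 0 ∨ γ ≠ 0 := by
    by_contra h
    push Not at h
    obtain ⟨rfl, rfl⟩ := h
    simp [circleAffine] at hp₁ hn₁; linarith
  obtain ⟨z₁, ⟨hz₁, hz₁'⟩, hq₁⟩ := circleAffine_exists_zero h₁ hp₁ hn₁
  obtain ⟨z₂, ⟨hz₂, hz₂'⟩, hq₂⟩ := circleAffine_exists_zero h₂ hp₂ hn₂
  obtain ⟨z₃, ⟨hz₃, hz₃'⟩, hq₃⟩ := circleAffine_exists_zero h₃ hp₃ hn₃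
  exact circleAffine_no_three_zeros hβγ (by linarith) (by linarith) (by linarith) (by linarith) hq₁ hq₂ hq₃

/-- **The circle toolkit** (registered form): an affine function of `P(u) = (2u²−1, 2u√(1−u²))` with `(β,γ) ≠ 0` has no
three zeros `z₁ < z₂ < z₃` in `(−1, 1]`. [folklore] -/
theorem circleAffine_toolkit : ∀ {α β γ : ℝ}, (β ≠ 0 ∨ γ ≠ 0) → ∀ {z₁ z₂ z₃ : ℝ}, z₁ < z₂ → z₂ < z₃ → -1 < z₁ → z₃ ≤ 1 → circleAffine α β γ z₁ = 0 → circleAffine α β γ z₂ = 0 → circleAffine α β γ z₃ = 0 → False :=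
  fun hβγ _ _ _ h₁₂ h₂₃ hz₁ hz₃ hq₁ hq₂ hq₃ => circleAffine_no_three_zeros hβγ h₁₂ h₂₃ hz₁ hz₃ hq₁ hq₂ hq₃

end

end Summit.PneNP.PneNP.Theorems
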